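import Summits.CriticalPhenomena.PercolationContinuityZ3.Theorems.PercAnnulusCrossingIICInsideFarQuasiIndependenceUpper
import HarnessLib

/-!
# A localised near group and the far points of Kesten's IIC are quasi-independent (lane RSW3, p1 gen 21)

builds on p205010 (kernel theorem, internal audit signed; external expert review pending) — NOT used in this file
(only `p_c(ℤ^d) > 0`).

RSW3 lane (LANE 3 `prim-rsw3`), seat `prim-rsw3-p1` (gen 21).  Helper file (`--supports stmt-CriticalPhenomena-4575`);
no definitions, no sorries.  Memo `run/shared/lean/prim/rsw3/P1-QM.md` §34.10 (first file of the GEN-22 plan: the GROUP version of the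
near-site-given-far lemmas, towards the tree formula without separation hypotheses).

The inside event `D_U = ⋂_{u ∈ U} {0 ↔ u in Λ(2b)}` (a near group `U ⊆ Λ(b)` joined to the origin inside `Λ(2b)`) is measurable, read in `Λ(2b)`,
and saturated in the cluster of the origin inside `Λ(2b)`; so both halves of the inside × far quasi-independence apply
(`…IICInsideFarQuasiIndependence`, `…IICInsideFarQuasiIndependenceUpper`, inner scale `m = 2b+1`, `a − 1 = s(2b+1)`):

* **`exists_iicMeasure_real_group_inter_biInter_two_sided_criticalProbI`** — at `p_c(ℤ^d)`, `d ≥ 2`, under (A2)□(s,L) + `CU⁺_l`: there are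
  `0 < c ≤ C` such that for every finite measure `ν` with Kesten's IIC limit property, every `b ≥ 1`, every finite `U` and every finite `S` off
  `Λ(l(s(2b+1)+1) − 1)`: **`c·ν(D_U)·ν(S ⊆ C(0)) ≤ ν(D_U ∩ {S ⊆ C(0)}) ≤ C·ν(D_U)·ν(S ⊆ C(0))`**.
References: H. Kesten, Probab. Theory Relat. Fields 73 (1986) §2; D. Basu, A. Sapozhnikov, ECP 22 (2017) Thm. 1.1.
-/

noncomputable section

namespace Summit.CriticalPhenomena.PercolationContinuityZ3.Theorems.Crossing

open MeasureTheory Filter Topology Literature.Probability.Percolation Literature.Probability.LatticeModels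
open Literature.Probability.Percolation.DCT16
open Summit.CriticalPhenomena.PercolationContinuityZ3.Theorems.SurfaceTension

variable {d : ℕ}

open Classical in
/-- **A LOCALISED NEAR GROUP AND THE FAR POINTS OF THE IIC ARE QUASI-INDEPENDENT** (`p_c(ℤ^d)`, `d ≥ 2`; (A2)□ at aspect `(s,L)`, `2 ≤ s ≤ L`,
`ϰ > 0`; `CU⁺_l(c_U)`, `l ≥ 2`, `c_U > 0`): there are `0 < c, C` such that for every finite measure `ν` with Kesten's IIC limit property, every
`b ≥ 1`, every finite set of sites `U` and every finite `S` with `z ∉ Λ(l(s(2b+1)+1) − 1)` on `S`, writing `D_U = ⋂_{u∈U}{0 ↔ u in Λ(2b)}`: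
**`c·ν(D_U)·ν(⋂_{z∈S}{0 ↔ z}) ≤ ν(D_U ∩ ⋂_{z∈S}{0 ↔ z}) ≤ C·ν(D_U)·ν(⋂_{z∈S}{0 ↔ z})`**. [cite: Kesten1986, §2] [cite: BasuSapozhnikov2017ECP, Thm. 1.1] -/
theorem exists_iicMeasure_real_group_inter_biInter_two_sided_criticalProbI (hd : 2 ≤ d) {s L : ℕ} (hs : 2 ≤ s) (hsL : s ≤ L)
    {ϰ : ℝ} (hϰ : 0 < ϰ) (hA2 : SetToSetQuasiMultAspectAt d (criticalProbI d) s L ϰ) {l : ℕ} (hl : 2 ≤ l) {cU : ℝ} (hcU : 0 < cU)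
    (hCU : ∀ a : ℕ, 1 ≤ a → ∀ E : Set (BondConfig (Site d)), IsUpperSet E → MeasurableSet E →
      cU * (bondPercolation (zdGraph d) (criticalProbI d)).real E ≤ (bondPercolation (zdGraph d) (criticalProbI d)).real (E ∩
        {ω : BondConfig (Site d) | ∀ t ∈ innerBoundary (zdGraph d) (box d a), ∀ s ∈ innerBoundary (zdGraph d) (box d (l * a)),
          ∀ t' ∈ innerBoundary (zdGraph d) (box d a), ∀ s' ∈ innerBoundary (zdGraph d) (box d (l * a)),
          ω ∈ openConnIn (↑((box d (l * a) \ box d a) ∪ innerBoundary (zdGraph d) (box d a)) : Set (Site d)) t s →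
          ω ∈ openConnIn (↑((box d (l * a) \ box d a) ∪ innerBoundary (zdGraph d) (box d a)) : Set (Site d)) t' s' →
          ω ∈ openConnIn (↑((box d (l * a) \ box d a) ∪ innerBoundary (zdGraph d) (box d a)) : Set (Site d)) s s'})) :
    ∃ c C : ℝ, 0 < c ∧ 0 < C ∧ ∀ (ν : Measure (BondConfig (Site d))) [IsFiniteMeasure ν],
      (∀ (F : Finset (Sym2 (Site d))) (E : Set (BondConfig (Site d))), MeasurableSet E → DeterminedBy E ↑F →
        Tendsto (fun n : ℕ => (bondPercolation (zdGraph d) (criticalProbI d)).real (E ∩ siteToBoundary d n) /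
          oneArmProb d (criticalProbI d) n) atTop (𝓝 (ν.real E))) →
      ∀ (b : ℕ) (U S : Finset (Site d)), 1 ≤ b → (∀ z ∈ S, z ∉ box d (l * (s * (2 * b + 1) + 1) - 1)) →
        c * ν.real (⋂ u ∈ U, (openConnIn (↑(box d (2 * b)) : Set (Site d)) (0 : Site d) u : Set (BondConfig (Site d)))) *
            ν.real (⋂ z ∈ S, (openConn (0 : Site d) z : Set (BondConfig (Site d)))) ≤
          ν.real ((⋂ u ∈ U, (openConnIn (↑(box d (2 * b)) : Set (Site d)) (0 : Site d) u : Set (BondConfig (Site d)))) ∩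
            ⋂ z ∈ S, (openConn (0 : Site d) z : Set (BondConfig (Site d)))) ∧
        ν.real ((⋂ u ∈ U, (openConnIn (↑(box d (2 * b)) : Set (Site d)) (0 : Site d) u : Set (BondConfig (Site d)))) ∩
            ⋂ z ∈ S, (openConn (0 : Site d) z : Set (BondConfig (Site d)))) ≤
          C * ν.real (⋂ u ∈ U, (openConnIn (↑(box d (2 * b)) : Set (Site d)) (0 : Site d) u : Set (BondConfig (Site d)))) *
            ν.real (⋂ z ∈ S, (openConn (0 : Site d) z : Set (BondConfig (Site d)))) := by
  obtain ⟨c, hc, hlow⟩ := exists_iicMeasure_real_inter_biInter_openConn_ge_mul_criticalProbI hd hs hsL hϰ hA2 hl hcU hCU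
  obtain ⟨C, hC, hup⟩ := exists_iicMeasure_real_inter_biInter_openConn_le_mul_criticalProbI hd hs hsL hϰ hA2 hl hcU hCU
  refine ⟨c, C, hc, hC, fun ν _ hν b U S hb hS => ?_⟩
  -- the inside event: measurable, read in `Λ(a−1)` with `a − 1 = s(2b+1)`, saturated in the cluster of `0` inside `Λ(2b)`
  have hmeas : MeasurableSet (⋂ u ∈ U, (openConnIn (↑(box d (2 * b)) : Set (Site d)) (0 : Site d) u : Set (BondConfig (Site d)))) :=
    MeasurableSet.biInter U.countable_toSet fun u _ => measurableSet_openConnIn _ 0 u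
  have hdet : DeterminedBy (⋂ u ∈ U, (openConnIn (↑(box d (2 * b)) : Set (Site d)) (0 : Site d) u : Set (BondConfig (Site d))))
      (↑((box d (s * (2 * b + 1) + 1 - 1)).sym2) : Set (Sym2 (Site d))) := by
    rw [Nat.add_sub_cancel]
    refine DeterminedBy.iInter fun u => DeterminedBy.iInter fun _ => ?_
    exact (determinedBy_openConnIn (↑(box d (2 * b))) 0 u (K := ↑(box d (2 * b)).sym2) (by rw [Finset.coe_sym2])).mono
      (Finset.coe_subset.2 (Finset.sym2_mono (box_mono d (by nlinarith))))
  have hsat : ∀ ω ω' : BondConfig (Site d), DCT16.clusterSet (box d (2 * b + 1 - 1)) ω = DCT16.clusterSet (box d (2 * b + 1 - 1)) ω' →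
      (ω ∈ ⋂ u ∈ U, (openConnIn (↑(box d (2 * b)) : Set (Site d)) (0 : Site d) u : Set (BondConfig (Site d))) ↔
        ω' ∈ ⋂ u ∈ U, (openConnIn (↑(box d (2 * b)) : Set (Site d)) (0 : Site d) u : Set (BondConfig (Site d)))) := by
    intro ω ω' h
    rw [Nat.add_sub_cancel] at h
    simp only [Set.mem_iInter]
    refine forall₂_congr fun u _ => ?_
    have h' := congrArg (fun A : Set (Site d) => u ∈ A) h
    simpa [DCT16.clusterSet] using h'
  refine ⟨hlow ν hν (s * (2 * b + 1) + 1) (by nlinarith) _ hdet hmeas S hS, ?_⟩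
  exact hup ν hν (2 * b + 1) (s * (2 * b + 1) + 1) (by omega) (by rw [Nat.add_sub_cancel]) (by rw [Nat.add_sub_cancel]; nlinarith)
    _ hmeas hdet hsat S hS

end Summit.CriticalPhenomena.PercolationContinuityZ3.Theorems.Crossing

end
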